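import Mathlib
import Literature.NumberTheory.Irrationality.BrownZudilin2022.CubicalForm
import Literature.NumberTheory.Irrationality.BrownZudilin2022.BarnesRepresentation
import Literature.Barriers.CriticalPhenomena.RigorousRGSmallParameterKatoFormula
import Summits.KontsevichZagierPeriods.Zeta5Search.CubicalSubstitution
import HarnessLib

/-!
# ζ(5) search — Beta integrals over the open cube for Brown–Zudilin's `J(p;q)` (cell `pub-zeta5`, seat ct-1 g11)

HONEST FRAMING: systematic search; no irrationality claim unless kernel-certified. Nothing in this file is an
irrationality result, a worthiness exponent or a denominator statement. It is the measure-theoretic half of the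
derivation of Brown–Zudilin's Barnes-type double integral (16) from the 12-parameter integral (10)
[BrownZudilin2022, Sect. 5]: after the two denominators of (10) are opened by Mellin–Barnes integrals
(`BarnesMellin.lean`), the integral over `(0,1)⁵` FACTORISES into five Euler Beta integrals.

* `integral_openCube_prod5` / `integrable_openCube_prod5` — Fubini on `(0,1)⁵` for a product of one-variable functions;
* `integral_beta_Ioo`, `integrableOn_beta_Ioo` — `∫₀¹ x^{u−1}(1−x)^{v−1} dx = Γ(u)Γ(v)/Γ(u+v)` (Mathlib's Beta integral);
* `zpow_ofReal_eq_exp` & co. — powers of positive reals as exponentials (for Laurent-monomial bookkeeping);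
* `integrandJ_eq_factor` — on the cube, `1 − y₃(1−y₁y₂) = (1−y₃)(1 + y₃y₁y₂/(1−y₃))`, so the integrand of (10) is
  `R(y) · (1+w₁)^{-(p₀+1)} (1+w₂)^{-(p₆+1)}`;
* `cube_factorisation` — `R(y) w₁^s w₂^t` is a product of five Beta integrands, and `integral_cube_factor` — its integral
  over the cube is the corresponding product of Gamma quotients.

Theorems only (no new definitions).
-/

noncomputable section

namespace Summit.KontsevichZagierPeriods.Zeta5Search.BarnesCube

open MeasureTheory Set Filter
open scoped Topology Real
open Literature.NumberTheory.Irrationality.BrownZudilin2022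
open Summit.KontsevichZagierPeriods.Zeta5Search.CubicalSubstitution (openCube_eq_pi measurableSet_openCube)
open Literature.Barriers.CriticalPhenomena.LongRangePhi4.Kato (cpow_ofReal_pos)

/-! ### 1. Fubini on the open cube for products of one-variable functions -/

/-- `∫_{(0,1)⁵} f₀(y₀)f₁(y₁)f₂(y₂)f₃(y₃)f₄(y₄) dy = ∏ᵢ ∫₀¹ fᵢ`. -/
theorem integral_openCube_prod5 (f0 f1 f2 f3 f4 : ℝ → ℂ) :
    ∫ y in openCube, f0 (y 0) * f1 (y 1) * f2 (y 2) * f3 (y 3) * f4 (y 4) =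
      (∫ x in Ioo (0:ℝ) 1, f0 x) * (∫ x in Ioo (0:ℝ) 1, f1 x) * (∫ x in Ioo (0:ℝ) 1, f2 x) *
        (∫ x in Ioo (0:ℝ) 1, f3 x) * (∫ x in Ioo (0:ℝ) 1, f4 x) := by
  have h := integral_fintype_prod_eq_prod (𝕜 := ℂ) (![f0, f1, f2, f3, f4] : Fin 5 → ℝ → ℂ)
    (μ := fun _ : Fin 5 => (volume : Measure ℝ).restrict (Ioo 0 1))
  simp only [Fin.prod_univ_five, Matrix.cons_val_zero, Matrix.cons_val_one, Matrix.cons_val] at h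
  rw [openCube_eq_pi, volume_pi, Measure.restrict_pi_pi]
  exact h

/-- A product of five functions integrable on `(0,1)` is integrable on the open cube. -/
theorem integrable_openCube_prod5 {f0 f1 f2 f3 f4 : ℝ → ℂ} (h0 : IntegrableOn f0 (Ioo 0 1)) (h1 : IntegrableOn f1 (Ioo 0 1))
    (h2 : IntegrableOn f2 (Ioo 0 1)) (h3 : IntegrableOn f3 (Ioo 0 1)) (h4 : IntegrableOn f4 (Ioo 0 1)) :
    IntegrableOn (fun y : Fin 5 → ℝ => f0 (y 0) * f1 (y 1) * f2 (y 2) * f3 (y 3) * f4 (y 4)) openCube := by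
  have h := Integrable.fintype_prod (f := (![f0, f1, f2, f3, f4] : Fin 5 → ℝ → ℂ))
    (μ := fun _ : Fin 5 => (volume : Measure ℝ).restrict (Ioo 0 1)) (by
      intro i; fin_cases i <;> assumption)
  simp only [Fin.prod_univ_five, Matrix.cons_val_zero, Matrix.cons_val_one, Matrix.cons_val] at h
  rw [IntegrableOn, openCube_eq_pi, volume_pi, Measure.restrict_pi_pi]
  exact h

/-! ### 2. Euler's Beta integral on `(0,1)` -/

/-- `∫₀¹ x^{u−1}(1−x)^{v−1} dx = Γ(u)Γ(v)/Γ(u+v)` for `Re u, Re v > 0` (as a set integral over `Ioo 0 1`). -/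
theorem integral_beta_Ioo {u v : ℂ} (hu : 0 < u.re) (hv : 0 < v.re) :
    ∫ x in Ioo (0:ℝ) 1, (x : ℂ) ^ (u - 1) * (1 - (x : ℂ)) ^ (v - 1) =
      Complex.Gamma u * Complex.Gamma v / Complex.Gamma (u + v) := by
  have hB : ∫ x in Ioo (0:ℝ) 1, (x : ℂ) ^ (u - 1) * (1 - (x : ℂ)) ^ (v - 1) = Complex.betaIntegral u v := by
    rw [Complex.betaIntegral, intervalIntegral.integral_of_le zero_le_one, integral_Ioc_eq_integral_Ioo]
  rw [hB, Complex.Gamma_mul_Gamma_eq_betaIntegral hu hv, mul_div_cancel_left₀]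
  apply Complex.Gamma_ne_zero
  intro n h
  have := congrArg Complex.re h
  simp at this
  linarith [n.cast_nonneg (α := ℝ)]

/-- The Beta integrand is integrable on `(0,1)` for `Re u, Re v > 0`. -/
theorem integrableOn_beta_Ioo {u v : ℂ} (hu : 0 < u.re) (hv : 0 < v.re) :
    IntegrableOn (fun x : ℝ => (x : ℂ) ^ (u - 1) * (1 - (x : ℂ)) ^ (v - 1)) (Ioo 0 1) := by
  have h := (Complex.betaIntegral_convergent hu hv).1
  -- `IntervalIntegrable … 0 1` gives integrability on `Ioc 0 1 ⊇ Ioo 0 1`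
  exact h.mono_set Ioo_subset_Ioc_self

/-! ### 3. Complex powers of positive reals as exponentials
(`(x:ℂ)^z = exp(z log x)` for `x > 0` is the tree's `Literature.Barriers.CriticalPhenomena.LongRangePhi4.Kato.cpow_ofReal_pos`) -/

/-- For real `x > 0` and an integer `n`: `((x^n : ℝ) : ℂ) = exp(n · log x)`. -/
theorem zpow_ofReal_eq_exp {x : ℝ} (hx : 0 < x) (n : ℤ) :
    ((x ^ n : ℝ) : ℂ) = Complex.exp ((n : ℂ) * (Real.log x : ℂ)) := by
  rw [Complex.ofReal_zpow, ← Complex.cpow_intCast, cpow_ofReal_pos hx]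

/-- For real `x > 0` and a natural `n`: `((x^n : ℝ) : ℂ) = exp(n · log x)`. -/
theorem pow_ofReal_eq_exp {x : ℝ} (hx : 0 < x) (n : ℕ) :
    ((x ^ n : ℝ) : ℂ) = Complex.exp ((n : ℂ) * (Real.log x : ℂ)) := by
  rw [Complex.ofReal_pow, ← Complex.cpow_natCast, cpow_ofReal_pos hx]

/-- `1 - (x:ℂ)` as the cast of the positive real `1 - x` in exponential form, for `x < 1`. -/
theorem one_sub_cpow_eq_exp {x : ℝ} (hx : x < 1) (z : ℂ) :
    (1 - (x : ℂ)) ^ z = Complex.exp (z * (Real.log (1 - x) : ℂ)) := by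
  rw [show (1 : ℂ) - (x : ℂ) = ((1 - x : ℝ) : ℂ) by push_cast; ring, cpow_ofReal_pos (by linarith)]


/-- Shifted form: `∫₀¹ x^{a}(1−x)^{b} dx = Γ(a+1)Γ(b+1)/Γ(a+b+2)` for `Re a, Re b > −1`. -/
theorem integral_beta_Ioo' {a b : ℂ} (ha : -1 < a.re) (hb : -1 < b.re) :
    ∫ x in Ioo (0:ℝ) 1, (x : ℂ) ^ a * (1 - (x : ℂ)) ^ b =
      Complex.Gamma (a + 1) * Complex.Gamma (b + 1) / Complex.Gamma (a + b + 2) := by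
  have h := integral_beta_Ioo (u := a + 1) (v := b + 1) (by simp; linarith) (by simp; linarith)
  simp only [add_sub_cancel_right] at h
  rw [h]; congr 2; ring

/-- Shifted form of the integrability of the Beta integrand. -/
theorem integrableOn_beta_Ioo' {a b : ℂ} (ha : -1 < a.re) (hb : -1 < b.re) :
    IntegrableOn (fun x : ℝ => (x : ℂ) ^ a * (1 - (x : ℂ)) ^ b) (Ioo 0 1) := by
  have h := integrableOn_beta_Ioo (u := a + 1) (v := b + 1) (by simp; linarith) (by simp; linarith)
  simp only [add_sub_cancel_right] at h
  exact h

/-! ### 4. The integrand of (10) on the cube: opening the two denominators -/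

/-- Pure algebra: `N/((aA)^k (aB)^l) = N/(a^k a^l) · (A^k)⁻¹ (B^l)⁻¹`. -/
theorem div_mul_pow_aux (N a A B : ℝ) (k l : ℕ) (ha : a ≠ 0) (hA : A ≠ 0) (hB : B ≠ 0) :
    N / ((a * A) ^ k * (a * B) ^ l) = N / (a ^ k * a ^ l) * ((A ^ k)⁻¹ * (B ^ l)⁻¹) := by
  rw [mul_pow, mul_pow]
  field_simp

/-- **Opening the denominators of (10).** On the open cube, with `w₁ = y₃y₁y₂/(1−y₃)`, `w₂ = y₃y₄y₅/(1−y₃)`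
(indices as in `integrandJ`: `y 2` is the printed `y₃`): `1 − y₃(1−y₁y₂) = (1−y₃)(1+w₁)` etc., hence
`integrandJ p q y = R(y) · (1+w₁)^{-(p₀+1)} (1+w₂)^{-(p₆+1)}`. [BrownZudilin2022, Sect. 5, "observing that
`1−y₃(1−y₁y₂) = (1 + y₃/(1−y₃) y₁y₂)(1−y₃)`"] -/
theorem integrandJ_eq_factor (p : Fin 7 → ℤ) (q : Fin 5 → ℤ) {m₀ m₆ : ℕ} (hp0 : p 0 = m₀) (hp6 : p 6 = m₆)
    {y : Fin 5 → ℝ} (hy : y ∈ openCube) :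
    integrandJ p q y =
      (y 0 ^ (p 1) * (1 - y 0) ^ (q 0) * y 1 ^ (p 2) * (1 - y 1) ^ (q 1) * y 2 ^ (p 3 + 1) * (1 - y 2) ^ (q 2) *
          y 3 ^ (p 4) * (1 - y 3) ^ (q 3) * y 4 ^ (p 5) * (1 - y 4) ^ (q 4) /
          ((1 - y 2) ^ (m₀ + 1) * (1 - y 2) ^ (m₆ + 1))) *
        (((1 + y 2 * (y 0 * y 1) / (1 - y 2)) ^ (m₀ + 1))⁻¹ * ((1 + y 2 * (y 3 * y 4) / (1 - y 2)) ^ (m₆ + 1))⁻¹) := by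
  have h0 := (hy 0).1; have h1 := (hy 1).1; have h3 := (hy 3).1; have h4 := (hy 4).1
  have h2 := (hy 2).1
  have h2' : 0 < 1 - y 2 := by linarith [(hy 2).2]
  have e1 : 1 - y 2 * (1 - y 0 * y 1) = (1 - y 2) * (1 + y 2 * (y 0 * y 1) / (1 - y 2)) := by
    field_simp; ring
  have e2 : 1 - y 2 * (1 - y 3 * y 4) = (1 - y 2) * (1 + y 2 * (y 3 * y 4) / (1 - y 2)) := by
    field_simp; ring
  have hA : (1 + y 2 * (y 0 * y 1) / (1 - y 2)) ≠ 0 := by positivity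
  have hB : (1 + y 2 * (y 3 * y 4) / (1 - y 2)) ≠ 0 := by positivity
  unfold integrandJ
  rw [e1, e2, hp0, hp6, show ((m₀ : ℤ) + 1) = ((m₀ + 1 : ℕ) : ℤ) by push_cast; ring,
    show ((m₆ : ℤ) + 1) = ((m₆ + 1 : ℕ) : ℤ) by push_cast; ring, zpow_natCast, zpow_natCast]
  exact div_mul_pow_aux _ _ _ _ _ _ h2'.ne' hA hB

/-- **Factorisation on the cube.** With `R(y)` the first factor of `integrandJ_eq_factor` and `w₁, w₂` as there,
`R(y) · w₁^s · w₂^t` is the product of five Beta integrands (one per coordinate). -/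
theorem cube_factorisation (p : Fin 7 → ℤ) (q : Fin 5 → ℤ) {m₀ m₆ : ℕ} (hp0 : p 0 = m₀) (hp6 : p 6 = m₆)
    (s t : ℂ) {y : Fin 5 → ℝ} (hy : y ∈ openCube) :
    ((y 0 ^ (p 1) * (1 - y 0) ^ (q 0) * y 1 ^ (p 2) * (1 - y 1) ^ (q 1) * y 2 ^ (p 3 + 1) * (1 - y 2) ^ (q 2) *
          y 3 ^ (p 4) * (1 - y 3) ^ (q 3) * y 4 ^ (p 5) * (1 - y 4) ^ (q 4) /
          ((1 - y 2) ^ (m₀ + 1) * (1 - y 2) ^ (m₆ + 1)) : ℝ) : ℂ) *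
      (((y 2 * (y 0 * y 1) / (1 - y 2) : ℝ) : ℂ) ^ s * ((y 2 * (y 3 * y 4) / (1 - y 2) : ℝ) : ℂ) ^ t) =
    ((y 0 : ℂ) ^ ((p 1 : ℂ) + s) * (1 - (y 0 : ℂ)) ^ ((q 0 : ℂ))) *
    ((y 1 : ℂ) ^ ((p 2 : ℂ) + s) * (1 - (y 1 : ℂ)) ^ ((q 1 : ℂ))) *
    ((y 2 : ℂ) ^ ((p 3 : ℂ) + 1 + s + t) * (1 - (y 2 : ℂ)) ^ ((q 2 : ℂ) - (p 0 : ℂ) - (p 6 : ℂ) - 2 - s - t)) *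
    ((y 3 : ℂ) ^ ((p 4 : ℂ) + t) * (1 - (y 3 : ℂ)) ^ ((q 3 : ℂ))) *
    ((y 4 : ℂ) ^ ((p 5 : ℂ) + t) * (1 - (y 4 : ℂ)) ^ ((q 4 : ℂ))) := by
  have h0 := (hy 0).1; have h1 := (hy 1).1; have h2 := (hy 2).1; have h3 := (hy 3).1; have h4 := (hy 4).1
  have g0 := (hy 0).2; have g1 := (hy 1).2; have g2 := (hy 2).2; have g3 := (hy 3).2; have g4 := (hy 4).2
  have h0' : 0 < 1 - y 0 := by linarith
  have h1' : 0 < 1 - y 1 := by linarith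
  have h2' : 0 < 1 - y 2 := by linarith
  have h3' : 0 < 1 - y 3 := by linarith
  have h4' : 0 < 1 - y 4 := by linarith
  have hw1 : 0 < y 2 * (y 0 * y 1) / (1 - y 2) := by positivity
  have hw2 : 0 < y 2 * (y 3 * y 4) / (1 - y 2) := by positivity
  rw [hp0, hp6, cpow_ofReal_pos hw1, cpow_ofReal_pos hw2,
    Real.log_div (by positivity) h2'.ne', Real.log_mul h2.ne' (by positivity), Real.log_mul h0.ne' h1.ne',
    Real.log_div (by positivity) h2'.ne', Real.log_mul h2.ne' (by positivity), Real.log_mul h3.ne' h4.ne']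
  simp only [Complex.ofReal_mul, Complex.ofReal_inv, zpow_ofReal_eq_exp h0, zpow_ofReal_eq_exp h1,
    zpow_ofReal_eq_exp h2, zpow_ofReal_eq_exp h3, zpow_ofReal_eq_exp h4, zpow_ofReal_eq_exp h0',
    zpow_ofReal_eq_exp h1', zpow_ofReal_eq_exp h2', zpow_ofReal_eq_exp h3', zpow_ofReal_eq_exp h4',
    pow_ofReal_eq_exp h2', cpow_ofReal_pos h0, cpow_ofReal_pos h1, cpow_ofReal_pos h2,
    cpow_ofReal_pos h3, cpow_ofReal_pos h4, one_sub_cpow_eq_exp g0, one_sub_cpow_eq_exp g1,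
    one_sub_cpow_eq_exp g2, one_sub_cpow_eq_exp g3, one_sub_cpow_eq_exp g4,
    div_eq_mul_inv, mul_inv, ← Complex.exp_neg, ← Complex.exp_add]
  congr 1
  push_cast
  ring


/-! ### 5. The six chamber inequalities and the cube integral of the factorised integrand -/

/-- The plain inequalities packed in `Chamber`. -/
theorem chamber_bounds {p : Fin 7 → ℤ} {q : Fin 5 → ℤ} {c₁ c₂ : ℝ} (h : Chamber p q c₁ c₂) :
    0 < c₁ ∧ c₁ < 1 + (p 0 : ℝ) ∧ c₁ < 1 + (p 1 : ℝ) ∧ c₁ < 1 + (p 2 : ℝ) ∧ 0 < c₂ ∧ c₂ < 1 + (p 4 : ℝ) ∧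
      c₂ < 1 + (p 5 : ℝ) ∧ c₂ < 1 + (p 6 : ℝ) ∧ (1 : ℝ) + p 0 + p 6 - q 2 < c₁ + c₂ ∧ c₁ + c₂ < (p 3 : ℝ) + 2 := by
  obtain ⟨h1, h2, h3, h4, h5, h6⟩ := h
  have m1 : (min (p 0) (min (p 1) (p 2)) : ℝ) ≤ (p 0 : ℝ) := by exact_mod_cast min_le_left _ _
  have m2 : (min (p 0) (min (p 1) (p 2)) : ℝ) ≤ (p 1 : ℝ) := by
    exact_mod_cast (min_le_right _ _).trans (min_le_left _ _)
  have m3 : (min (p 0) (min (p 1) (p 2)) : ℝ) ≤ (p 2 : ℝ) := by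
    exact_mod_cast (min_le_right _ _).trans (min_le_right _ _)
  have m4 : (min (p 4) (min (p 5) (p 6)) : ℝ) ≤ (p 4 : ℝ) := by exact_mod_cast min_le_left _ _
  have m5 : (min (p 4) (min (p 5) (p 6)) : ℝ) ≤ (p 5 : ℝ) := by
    exact_mod_cast (min_le_right _ _).trans (min_le_left _ _)
  have m6 : (min (p 4) (min (p 5) (p 6)) : ℝ) ≤ (p 6 : ℝ) := by
    exact_mod_cast (min_le_right _ _).trans (min_le_right _ _)
  push_cast at h2 h4
  refine ⟨h1, by linarith, by linarith, by linarith, h3, by linarith, by linarith, by linarith, h5, h6⟩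

/-- **The cube integral of the factorised integrand** is a product of five Beta values: for `(c₁,c₂)` in the
chamber and `s = −c₁+iy₁`, `t = −c₂+iy₂`,
`∫_{(0,1)⁵} ∏ᵢ fᵢ = [Γ(p₁+1+s)Γ(q₁+1)/Γ(p₁+q₁+2+s)] [Γ(p₂+1+s)Γ(q₂+1)/Γ(p₂+q₂+2+s)]
 [Γ(p₃+2+s+t)Γ(q₃−p₀−p₆−1−s−t)/Γ(p₃+q₃−p₀−p₆+1)] [Γ(p₄+1+t)Γ(q₄+1)/Γ(p₄+q₄+2+t)] [Γ(p₅+1+t)Γ(q₅+1)/Γ(p₅+q₅+2+t)]`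
(printed indices; "the Eulerian integral `∫₀^∞ z^{α−1}(1+z)^{−α−β}dz = Γ(α)Γ(β)/Γ(α+β)`" of [BrownZudilin2022,
Sect. 5] is the middle factor, here taken over `(0,1)` in the variable `y₃`). -/
theorem integral_cube_factor (p : Fin 7 → ℤ) (q : Fin 5 → ℤ) (hq : ∀ j, 0 ≤ q j) {c₁ c₂ : ℝ}
    (hch : Chamber p q c₁ c₂) (y₁ y₂ : ℝ) :
    ∫ y in openCube,
      ((y 0 : ℂ) ^ ((p 1 : ℂ) + (-(c₁ : ℂ) + (y₁ : ℂ) * Complex.I)) * (1 - (y 0 : ℂ)) ^ ((q 0 : ℂ))) *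
      ((y 1 : ℂ) ^ ((p 2 : ℂ) + (-(c₁ : ℂ) + (y₁ : ℂ) * Complex.I)) * (1 - (y 1 : ℂ)) ^ ((q 1 : ℂ))) *
      ((y 2 : ℂ) ^ ((p 3 : ℂ) + 1 + (-(c₁ : ℂ) + (y₁ : ℂ) * Complex.I) + (-(c₂ : ℂ) + (y₂ : ℂ) * Complex.I)) *
        (1 - (y 2 : ℂ)) ^ ((q 2 : ℂ) - (p 0 : ℂ) - (p 6 : ℂ) - 2 - (-(c₁ : ℂ) + (y₁ : ℂ) * Complex.I) -
          (-(c₂ : ℂ) + (y₂ : ℂ) * Complex.I))) *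
      ((y 3 : ℂ) ^ ((p 4 : ℂ) + (-(c₂ : ℂ) + (y₂ : ℂ) * Complex.I)) * (1 - (y 3 : ℂ)) ^ ((q 3 : ℂ))) *
      ((y 4 : ℂ) ^ ((p 5 : ℂ) + (-(c₂ : ℂ) + (y₂ : ℂ) * Complex.I)) * (1 - (y 4 : ℂ)) ^ ((q 4 : ℂ))) =
    (Complex.Gamma ((p 1 : ℂ) + 1 + (-(c₁ : ℂ) + (y₁ : ℂ) * Complex.I)) * Complex.Gamma ((q 0 : ℂ) + 1) /
        Complex.Gamma ((p 1 : ℂ) + (q 0 : ℂ) + 2 + (-(c₁ : ℂ) + (y₁ : ℂ) * Complex.I))) *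
    (Complex.Gamma ((p 2 : ℂ) + 1 + (-(c₁ : ℂ) + (y₁ : ℂ) * Complex.I)) * Complex.Gamma ((q 1 : ℂ) + 1) /
        Complex.Gamma ((p 2 : ℂ) + (q 1 : ℂ) + 2 + (-(c₁ : ℂ) + (y₁ : ℂ) * Complex.I))) *
    (Complex.Gamma ((p 3 : ℂ) + 2 + (-(c₁ : ℂ) + (y₁ : ℂ) * Complex.I) + (-(c₂ : ℂ) + (y₂ : ℂ) * Complex.I)) *
        Complex.Gamma ((q 2 : ℂ) - (p 0 : ℂ) - (p 6 : ℂ) - 1 - (-(c₁ : ℂ) + (y₁ : ℂ) * Complex.I) -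
          (-(c₂ : ℂ) + (y₂ : ℂ) * Complex.I)) / Complex.Gamma ((p 3 : ℂ) + (q 2 : ℂ) - (p 0 : ℂ) - (p 6 : ℂ) + 1)) *
    (Complex.Gamma ((p 4 : ℂ) + 1 + (-(c₂ : ℂ) + (y₂ : ℂ) * Complex.I)) * Complex.Gamma ((q 3 : ℂ) + 1) /
        Complex.Gamma ((p 4 : ℂ) + (q 3 : ℂ) + 2 + (-(c₂ : ℂ) + (y₂ : ℂ) * Complex.I))) *
    (Complex.Gamma ((p 5 : ℂ) + 1 + (-(c₂ : ℂ) + (y₂ : ℂ) * Complex.I)) * Complex.Gamma ((q 4 : ℂ) + 1) /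
        Complex.Gamma ((p 5 : ℂ) + (q 4 : ℂ) + 2 + (-(c₂ : ℂ) + (y₂ : ℂ) * Complex.I))) := by
  obtain ⟨hc1, b0, b1, b2, hc2, b4, b5, b6, hlo, hhi⟩ := chamber_bounds hch
  have hq0 : (0:ℝ) ≤ q 0 := by exact_mod_cast hq 0
  have hq1 : (0:ℝ) ≤ q 1 := by exact_mod_cast hq 1
  have hq3 : (0:ℝ) ≤ q 3 := by exact_mod_cast hq 3
  have hq4 : (0:ℝ) ≤ q 4 := by exact_mod_cast hq 4
  set s : ℂ := -(c₁ : ℂ) + (y₁ : ℂ) * Complex.I with hs_def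
  set t : ℂ := -(c₂ : ℂ) + (y₂ : ℂ) * Complex.I with ht_def
  have hs : s.re = -c₁ := by simp [hs_def]
  have ht : t.re = -c₂ := by simp [ht_def]
  rw [integral_openCube_prod5 (fun x : ℝ => (x : ℂ) ^ ((p 1 : ℂ) + s) * (1 - (x : ℂ)) ^ ((q 0 : ℂ)))
      (fun x : ℝ => (x : ℂ) ^ ((p 2 : ℂ) + s) * (1 - (x : ℂ)) ^ ((q 1 : ℂ)))
      (fun x : ℝ => (x : ℂ) ^ ((p 3 : ℂ) + 1 + s + t) * (1 - (x : ℂ)) ^ ((q 2 : ℂ) - (p 0 : ℂ) - (p 6 : ℂ) - 2 - s - t))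
      (fun x : ℝ => (x : ℂ) ^ ((p 4 : ℂ) + t) * (1 - (x : ℂ)) ^ ((q 3 : ℂ)))
      (fun x : ℝ => (x : ℂ) ^ ((p 5 : ℂ) + t) * (1 - (x : ℂ)) ^ ((q 4 : ℂ))),
    integral_beta_Ioo' (by simp [hs]; linarith) (by simp; linarith),
    integral_beta_Ioo' (by simp [hs]; linarith) (by simp; linarith),
    integral_beta_Ioo' (by simp [hs, ht]; linarith) (by simp [hs, ht]; linarith),
    integral_beta_Ioo' (by simp [ht]; linarith) (by simp; linarith),
    integral_beta_Ioo' (by simp [ht]; linarith) (by simp; linarith)]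
  have e1 : (p 1 : ℂ) + s + (q 0 : ℂ) + 2 = (p 1 : ℂ) + (q 0 : ℂ) + 2 + s := by ring
  have e2 : (p 2 : ℂ) + s + (q 1 : ℂ) + 2 = (p 2 : ℂ) + (q 1 : ℂ) + 2 + s := by ring
  have e3 : (p 3 : ℂ) + 1 + s + t + 1 = (p 3 : ℂ) + 2 + s + t := by ring
  have e3' : (q 2 : ℂ) - (p 0 : ℂ) - (p 6 : ℂ) - 2 - s - t + 1 = (q 2 : ℂ) - (p 0 : ℂ) - (p 6 : ℂ) - 1 - s - t := by ring
  have e3'' : (p 3 : ℂ) + 1 + s + t + ((q 2 : ℂ) - (p 0 : ℂ) - (p 6 : ℂ) - 2 - s - t) + 2 =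
      (p 3 : ℂ) + (q 2 : ℂ) - (p 0 : ℂ) - (p 6 : ℂ) + 1 := by ring
  have e4 : (p 4 : ℂ) + t + (q 3 : ℂ) + 2 = (p 4 : ℂ) + (q 3 : ℂ) + 2 + t := by ring
  have e5 : (p 5 : ℂ) + t + (q 4 : ℂ) + 2 = (p 5 : ℂ) + (q 4 : ℂ) + 2 + t := by ring
  have e1a : (p 1 : ℂ) + s + 1 = (p 1 : ℂ) + 1 + s := by ring
  have e2a : (p 2 : ℂ) + s + 1 = (p 2 : ℂ) + 1 + s := by ring
  have e4a : (p 4 : ℂ) + t + 1 = (p 4 : ℂ) + 1 + t := by ring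
  have e5a : (p 5 : ℂ) + t + 1 = (p 5 : ℂ) + 1 + t := by ring
  rw [e1, e2, e3, e3', e3'', e4, e5, e1a, e2a, e4a, e5a]

/-- The factorised integrand is integrable on the open cube (same chamber conditions). -/
theorem integrableOn_cube_factor (p : Fin 7 → ℤ) (q : Fin 5 → ℤ) (hq : ∀ j, 0 ≤ q j) {c₁ c₂ : ℝ}
    (hch : Chamber p q c₁ c₂) (y₁ y₂ : ℝ) :
    IntegrableOn (fun y : Fin 5 → ℝ =>
      ((y 0 : ℂ) ^ ((p 1 : ℂ) + (-(c₁ : ℂ) + (y₁ : ℂ) * Complex.I)) * (1 - (y 0 : ℂ)) ^ ((q 0 : ℂ))) *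
      ((y 1 : ℂ) ^ ((p 2 : ℂ) + (-(c₁ : ℂ) + (y₁ : ℂ) * Complex.I)) * (1 - (y 1 : ℂ)) ^ ((q 1 : ℂ))) *
      ((y 2 : ℂ) ^ ((p 3 : ℂ) + 1 + (-(c₁ : ℂ) + (y₁ : ℂ) * Complex.I) + (-(c₂ : ℂ) + (y₂ : ℂ) * Complex.I)) *
        (1 - (y 2 : ℂ)) ^ ((q 2 : ℂ) - (p 0 : ℂ) - (p 6 : ℂ) - 2 - (-(c₁ : ℂ) + (y₁ : ℂ) * Complex.I) -
          (-(c₂ : ℂ) + (y₂ : ℂ) * Complex.I))) *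
      ((y 3 : ℂ) ^ ((p 4 : ℂ) + (-(c₂ : ℂ) + (y₂ : ℂ) * Complex.I)) * (1 - (y 3 : ℂ)) ^ ((q 3 : ℂ))) *
      ((y 4 : ℂ) ^ ((p 5 : ℂ) + (-(c₂ : ℂ) + (y₂ : ℂ) * Complex.I)) * (1 - (y 4 : ℂ)) ^ ((q 4 : ℂ)))) openCube := by
  obtain ⟨hc1, b0, b1, b2, hc2, b4, b5, b6, hlo, hhi⟩ := chamber_bounds hch
  have hq0 : (0:ℝ) ≤ q 0 := by exact_mod_cast hq 0
  have hq1 : (0:ℝ) ≤ q 1 := by exact_mod_cast hq 1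
  have hq3 : (0:ℝ) ≤ q 3 := by exact_mod_cast hq 3
  have hq4 : (0:ℝ) ≤ q 4 := by exact_mod_cast hq 4
  set s : ℂ := -(c₁ : ℂ) + (y₁ : ℂ) * Complex.I with hs_def
  set t : ℂ := -(c₂ : ℂ) + (y₂ : ℂ) * Complex.I with ht_def
  have hs : s.re = -c₁ := by simp [hs_def]
  have ht : t.re = -c₂ := by simp [ht_def]
  have h := integrable_openCube_prod5
    (f0 := fun x : ℝ => (x : ℂ) ^ ((p 1 : ℂ) + s) * (1 - (x : ℂ)) ^ ((q 0 : ℂ)))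
    (f1 := fun x : ℝ => (x : ℂ) ^ ((p 2 : ℂ) + s) * (1 - (x : ℂ)) ^ ((q 1 : ℂ)))
    (f2 := fun x : ℝ => (x : ℂ) ^ ((p 3 : ℂ) + 1 + s + t) * (1 - (x : ℂ)) ^ ((q 2 : ℂ) - (p 0 : ℂ) - (p 6 : ℂ) - 2 - s - t))
    (f3 := fun x : ℝ => (x : ℂ) ^ ((p 4 : ℂ) + t) * (1 - (x : ℂ)) ^ ((q 3 : ℂ)))
    (f4 := fun x : ℝ => (x : ℂ) ^ ((p 5 : ℂ) + t) * (1 - (x : ℂ)) ^ ((q 4 : ℂ)))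
    (integrableOn_beta_Ioo' (by simp [hs]; linarith) (by simp; linarith))
    (integrableOn_beta_Ioo' (by simp [hs]; linarith) (by simp; linarith))
    (integrableOn_beta_Ioo' (by simp [hs, ht]; linarith) (by simp [hs, ht]; linarith))
    (integrableOn_beta_Ioo' (by simp [ht]; linarith) (by simp; linarith))
    (integrableOn_beta_Ioo' (by simp [ht]; linarith) (by simp; linarith))
  exact h

end Summit.KontsevichZagierPeriods.Zeta5Search.BarnesCube

end
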